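import Mathlib
import HarnessLib
import Summits.HubbardSuperconductivity.HubbardSuperconductivity.Theorems.KLProgrammeKLRegimeTwoVolumeTowerStepCovFlowStep
import Summits.HubbardSuperconductivity.HubbardSuperconductivity.Theorems.KLProgrammeKLRegimeTwoVolumeTowerStepCovTelescopeTop
import Summits.HubbardSuperconductivity.HubbardSuperconductivity.Theorems.KLProgrammeKLRegimeTwoVolumeTowerStepCovData
import Summits.HubbardSuperconductivity.HubbardSuperconductivity.Theorems.KLProgrammeKLRegimeThinOverlapIncrementTelescopeRegime

/-!
# K3 VL child `KLRegimeVolumeLimitV17F2` (stmt-HubbardSuperconductivity-20440), located item #23 «W2-HALF-VL», COV/SEC shallow half, part 3 (ALL STEPS): the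
# `ScaleCovData` bundle of the tower's step covariance `klStepCov V M β μ K_n k` AT THE TOP FLOW FRAME FOR EVERY STEP `k ≥ 1` — shallow steps by the
# frame telescope from the base `m₀ = 2k+6` (pieces of part 3 (FLOW STEP), decaying like `4^{−i}`), deep steps by the `_vol` door — in the `(1 + Λ_w·tnorm)`
# currency with ONE rate condition `Λ_w·4ⁿ ≤ ρc`, on any lattice `V` (`TowerVolumeDataT.cov` of both volumes, `TowerCrossData.cov`)

Cell `gate-hubbard-kl`, seat p3 (g16), lead of #23.  The cov/sec twin of p3 g15's `transferWtData_klTowerTransfer_flow_all` («W2H-OVL-CURRENCY»): at the top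
frame the deep window `4^{n+2}·U ≤ 4^{2k+d}` fails for the shallow steps; there the telescope door `scaleCovData_klStepCov_flow_of_pieces` (p603893) runs from
`K_{2k+6}` with the pieces `φ i = ψ i := 𝒦·(M/β)/(Λ_{k+2}²·4^{2k+6+i})` of `stepCov_pieces_flow` converted to the `(1 + Λ_w·tnorm)` currency at a weight scale
`n_w` between `max(Λ_w, ρ_w/(4·4ⁿ))` and four times it (`exists_klScale_between`), so that `Λ_{n_w}·4^i ≤ ρ_w` on every piece; the geometric sum is
`≤ 𝒦·(M/β)/Λ_{k+2}`.  The Gram constant and the entry sup are the window-free ones of `gram_entry_klStepCov_klEng` (p601425) in both regimes.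

* `scaleCovData_mono` — `ScaleCovData` is monotone in its row constant and entry sup;
* `scaleCovData_klStepCov_flow_shallow (dd)` — the shallow steps along the chain (`2k+6 ≤ m₀`, window at the base only);
* **`scaleCovData_klStepCov_flow_all (dd) (hdd : 10 ≤ dd)`** — `ScaleCovData (klStepCov V M β μ K_n k) Λ_w κ_k (Cα·(M/β)/Λ_{k+2}) (16·Cκ·klE0)` for EVERY
  `1 ≤ k`, `k + 2 ≤ n_β + 1`, `0 ≤ Λ_w ≤ Λ_{k+2}`, `Λ_w·4ⁿ ≤ ρc`, one absolute `Cκ, Cα, ρc`.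

Everything is proved; no definitions besides none; no sorry.  Nothing asserts any stub, K3, VL or superconductivity. [cite: BenfattoGiulianiMastropietro2006, §2.8 (2.80)–(2.81), §3 (3.2)–(3.8)]
-/

noncomputable section

namespace Summit.HubbardSuperconductivity.HubbardSuperconductivity.Theorems.TorusFourierL2

set_option linter.dupNamespace false -- summit = problem name (single-conjunct summit), D-0017

open Set Finset Literature.MathematicalPhysics.QuantumLattice Literature.MathematicalPhysics.QuantumLattice.BandSectorCounting
open Literature.MathematicalPhysics.QuantumLattice.FermiRG Literature.Probability.LatticeModels Literature.Analysis.SpecialFunctions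
open Summit.HubbardSuperconductivity.HubbardSuperconductivity.Theorems.DispersionFlow
open Summit.HubbardSuperconductivity.HubbardSuperconductivity.Theorems.KLRegimeSplit
open Summit.HubbardSuperconductivity.HubbardSuperconductivity.Theorems.KLProgrammeLegKernels
open Summit.HubbardSuperconductivity.HubbardSuperconductivity.Theorems.PerturbedFermiCurve
open Summit.HubbardSuperconductivity.HubbardSuperconductivity.Theorems.KLRegimeWick
open Summit.HubbardSuperconductivity.HubbardSuperconductivity.Theorems.EngineV8
open Summit.HubbardSuperconductivity.HubbardSuperconductivity.Theorems.TwoVolumeSource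
open Summit.HubbardSuperconductivity.HubbardSuperconductivity.Theorems.TwoVolumeDefect
open scoped Real

open Classical

/-- **`ScaleCovData` is monotone in its row constant and entry sup.** [folklore] -/
theorem scaleCovData_mono {V M N : ℕ} [NeZero V] {C : Matrix (SpaceTimeIdx V M × SectorLeg N) (SpaceTimeIdx V M × SectorLeg N) ℂ}
    {Λ κ αW αW' sW sW' : ℝ} (h : ScaleCovData C Λ κ αW sW) (hα : αW ≤ αW') (hs : sW ≤ sW') : ScaleCovData C Λ κ αW' sW' where
  κ_pos := h.κ_pos
  gram := h.gram
  αW_pos := h.αW_pos.trans_le hα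
  row X := (h.row X).trans hα
  col Y := (h.col Y).trans hα
  sW_nonneg := h.sW_nonneg.trans hs
  entry X Y := (h.entry X Y).trans hs

/-- `Λ_{k+2}·4^{m₀} ≥ 8` for `2k + 6 ≤ m₀` (`Λ_{k+2} = 4^{−(k+2)}/32`). [folklore] -/
theorem eight_le_klScale_mul_pow {k m₀ : ℕ} (hkm : 2 * k + 6 ≤ m₀) : 8 ≤ klScale klE0 (k + 2) * (4 : ℝ) ^ m₀ := by
  have hΛ : klScale klE0 (k + 2) = (1 / 32) * ((4 : ℝ) ^ (k + 2))⁻¹ := by rw [klScale, klE0]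
  have hpow : (4 : ℝ) ^ (2 * k + 6) ≤ (4 : ℝ) ^ m₀ := pow_le_pow_right₀ (by norm_num) hkm
  have e : (4 : ℝ) ^ (2 * k + 6) = (4 : ℝ) ^ (k + 2) * ((4 : ℝ) ^ (k + 2) * 16) := by
    rw [show (16 : ℝ) = (4 : ℝ) ^ 2 by norm_num, ← pow_add, ← pow_add]; congr 1; omega
  have h4k : (16 : ℝ) ≤ (4 : ℝ) ^ (k + 2) := by
    calc (16 : ℝ) = (4 : ℝ) ^ 2 := by norm_num
      _ ≤ (4 : ℝ) ^ (k + 2) := pow_le_pow_right₀ (by norm_num) (by omega)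
  have h0 : (0 : ℝ) < (4 : ℝ) ^ (k + 2) := by positivity
  rw [hΛ]
  rw [e] at hpow
  have h1 : (1 / 32) * ((4 : ℝ) ^ (k + 2))⁻¹ * (4 : ℝ) ^ m₀ ≥ (1 / 32) * ((4 : ℝ) ^ (k + 2))⁻¹ * ((4 : ℝ) ^ (k + 2) * ((4 : ℝ) ^ (k + 2) * 16)) :=
    mul_le_mul_of_nonneg_left hpow (by positivity)
  have h2 : (1 / 32) * ((4 : ℝ) ^ (k + 2))⁻¹ * ((4 : ℝ) ^ (k + 2) * ((4 : ℝ) ^ (k + 2) * 16)) = (4 : ℝ) ^ (k + 2) / 2 := by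
    field_simp; ring
  rw [h2] at h1
  linarith

set_option maxHeartbeats 3200000 in -- long binder lists of the door and the pieces
/-- **`ScaleCovData` of the tower's step covariance at the end of the flow chain for the SHALLOW steps, by name**: base `2k+6 ≤ m₀` (window at the base
only), pieces of `stepCov_pieces_flow` in the `(1 + Λ_w·tnorm)` currency, `Λ_w·4^{m₀+d} ≤ ρc`. [cite: BenfattoGiulianiMastropietro2006, §2.8 (2.80)–(2.81), §3 (3.2)–(3.8)] -/
theorem scaleCovData_klStepCov_flow_shallow (dd : ℕ) :
    ∃ Cκ Cα ρc : ℝ, 0 < Cκ ∧ 0 < Cα ∧ 0 < ρc ∧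
      ∀ (G : GeoConsts) (P : SplitConsts) (R : RenConsts) (Q : EngConsts) (cc : ℝ), P.WF → R.WF2 → 0 < cc → cc ≤ EngineV8.klEngC₃6 P R →
      ∀ μ ∈ klWindowC, ∀ U : ℝ, 0 < U → U ≤ min (EngineV8.klEngU₀3 P R cc) (1 / (R.Gfr 3 + 1)) → U ≤ EngineV8.klEngU₀4 P R cc →
      ∀ β : ℝ, klBetaMin ≤ β → β ≤ Real.exp (cc / U ^ 2) →
      ∀ (L M : ℕ) [NeZero L] [NeZero M], EngineV8.klEngL₃ β U ≤ L → EngineV8.klEngM₃ β U L ≤ M →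
      ∀ m₀ d : ℕ, 1 ≤ m₀ → m₀ + d ≤ nScales β + 1 → HistP klPredsV17F2 L M G P Q R β U μ 0 (m₀ + d) →
        ∀ (V : ℕ) [NeZero V], EngineV8.klEngL₃ β U ≤ V → EngineV8.klEngM₃ β U V ≤ M →
        ∀ k : ℕ, 1 ≤ k → k + 2 ≤ nScales β + 1 → 2 * k + 6 ≤ m₀ → (4 : ℝ) ^ (m₀ + 2) * U ≤ (4 : ℝ) ^ (2 * k + dd) →
        ∀ Λw : ℝ, 0 ≤ Λw → Λw ≤ klScale klE0 (k + 2) → Λw * (4 : ℝ) ^ (m₀ + d) ≤ ρc →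
          ScaleCovData (klStepCov V M β μ (klFlowFrameU L M β U μ (m₀ + d)) k) Λw
            (Real.sqrt (Cκ * (klScale klE0 k / klScale klE0 (k + 2)) * (klE0 * ((8 : ℝ) ^ k)⁻¹)))
            (Cα * ((M : ℝ) / β) / klScale klE0 (k + 2)) (16 * Cκ * klE0) := by
  obtain ⟨Cκ, Cα₀, hCκ, hCα₀, hdoor⟩ := scaleCovData_klStepCov_flow_of_pieces dd
  obtain ⟨𝒦, ρw, h𝒦, hρw, hρw1, hpieces⟩ := stepCov_pieces_flow
  refine ⟨Cκ, Cα₀ + 𝒦, ρw / 4, hCκ, by positivity, by positivity, ?_⟩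
  intro G P R Q cc hP hR2 hcc hcc6 μ hμ U hU hUle hU4 β hβmin hβc L M _ _ hL3 hM3 m₀ d hm1 hN hhist V _ hV3 hVM3 k hk hkN hkm hwin Λw hΛw0 hΛwle hΛwρ
  have hβ0 : 0 < β := pos_of_klBetaMin_le hβmin
  have hMβ : β ≤ (M : ℝ) := EngineV8.le_of_klEngM₃_le hβmin hL3 hM3
  have hM0 : (0 : ℝ) < M := lt_of_lt_of_le hβ0 hMβ
  have he : (0 : ℝ) < klE0 := by norm_num [klE0]
  have hΛs : 0 < klScale klE0 (k + 2) := klth_klScale_pos _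
  have hΛe : klScale klE0 (k + 2) ≤ klE0 := klScale_le_e0 he.le (k + 2)
  have hx0 : (0 : ℝ) < (4 : ℝ) ^ (m₀ + d) := by positivity
  -- the weight scale between `x := max Λ_w (ρ_w/(4·4^{m₀+d}))` and `4x`
  set x : ℝ := max Λw (ρw / (4 * (4 : ℝ) ^ (m₀ + d))) with hxdef
  have hxpos : 0 < x := lt_of_lt_of_le (by positivity) (le_max_right _ _)
  have hxe : x ≤ klE0 := by
    refine max_le (hΛwle.trans hΛe) ?_
    rw [div_le_iff₀ (by positivity), klE0]
    have h8 : (4 : ℝ) ^ 8 ≤ (4 : ℝ) ^ (m₀ + d) := pow_le_pow_right₀ (by norm_num) (by omega)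
    nlinarith only [hρw1, h8]
  obtain ⟨nw, hnw1, hnw2⟩ := exists_klScale_between hxpos hxe
  have hΛnw : Λw ≤ klScale klE0 nw := (le_max_left _ _).trans hnw1
  have hx4 : x * (4 : ℝ) ^ (m₀ + d) ≤ ρw / 4 := by
    rcases le_total Λw (ρw / (4 * (4 : ℝ) ^ (m₀ + d))) with hc | hc
    · rw [hxdef, max_eq_right hc]; rw [div_mul_eq_mul_div, div_le_div_iff₀ (by positivity) (by norm_num)]; nlinarith only [hρw.le, hx0]
    · rw [hxdef, max_eq_left hc]; exact hΛwρ
  have hnwi : ∀ i < d, klScale klE0 nw * (4 : ℝ) ^ (m₀ + i) ≤ ρw := by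
    intro i hi
    have h1 : (4 : ℝ) ^ (m₀ + i) * 4 ≤ (4 : ℝ) ^ (m₀ + d) := by
      rw [← pow_succ]; exact pow_le_pow_right₀ (by norm_num) (by omega)
    have h2 : klScale klE0 nw * (4 : ℝ) ^ (m₀ + i) ≤ 4 * x * (4 : ℝ) ^ (m₀ + i) := mul_le_mul_of_nonneg_right hnw2.le (by positivity)
    have h3 : 4 * x * (4 : ℝ) ^ (m₀ + i) ≤ x * (4 : ℝ) ^ (m₀ + d) := by nlinarith only [h1, hxpos]
    linarith only [h2, h3, hx4, hρw]
  -- the pieces along the chain, converted to the `(1 + Λ_w·tnorm)` currency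
  have hPc := fun i (hi : i < d) => hpieces G P R Q cc hR2 hcc hcc6 μ hμ U hU hUle β hβmin hβc L M hL3 hM3 (m₀ + d) hN hhist V hV3 hVM3 k hk hkN (m₀ + i)
    (by omega) (by omega) nw (hnwi i hi)
  set φ : ℕ → ℝ := fun i => 𝒦 * ((M : ℝ) / β) / (klScale klE0 (k + 2) ^ 2 * (4 : ℝ) ^ (m₀ + i)) with hφ
  have hd := hdoor G P R Q cc hP hR2 hcc hcc6 μ hμ U hU hUle hU4 β hβmin hβc L M hL3 hM3 m₀ d hm1 hN hhist V hV3 hVM3 k hk hkN hwin Λw hΛw0 hΛwle φ φ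
    (fun i hi X => rowWt_tnorm_le_of_klScaleWt hβ0.le hΛnw _ X ((hPc i hi).1 X))
    (fun i hi Y => colWt_tnorm_le_of_klScaleWt hβ0.le hΛnw _ Y ((hPc i hi).2.1 Y))
    (fun i hi X => rowWt_tnorm_le_of_klScaleWt hβ0.le hΛnw _ X ((hPc i hi).2.2.1 X))
    (fun i hi Y => colWt_tnorm_le_of_klScaleWt hβ0.le hΛnw _ Y ((hPc i hi).2.2.2 Y))
  -- the geometric sum `Σ_{i<d} 2φ i ≤ 𝒦·(M/β)/Λ_{k+2}`
  refine scaleCovData_mono hd ?_ le_rfl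
  have e : ∀ i, φ i + φ i = (2 * 𝒦 * ((M : ℝ) / β) / klScale klE0 (k + 2) ^ 2) / (4 : ℝ) ^ (m₀ + i) := fun i => by rw [hφ]; field_simp; ring
  simp_rw [e]
  refine (add_le_add le_rfl (sum_div_four_pow_le (c := 2 * 𝒦 * ((M : ℝ) / β) / klScale klE0 (k + 2) ^ 2) (by positivity) m₀ d)).trans ?_
  have h8 := eight_le_klScale_mul_pow hkm
  rw [add_mul, add_div]
  refine add_le_add le_rfl ?_
  rw [show 4 / 3 * (2 * 𝒦 * ((M : ℝ) / β) / klScale klE0 (k + 2) ^ 2 / (4 : ℝ) ^ m₀) =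
      (𝒦 * ((M : ℝ) / β) / klScale klE0 (k + 2)) * ((8 / 3) / (klScale klE0 (k + 2) * (4 : ℝ) ^ m₀)) by field_simp; ring]
  refine mul_le_of_le_one_right (by positivity) ?_
  rw [div_le_one (by positivity)]
  linarith

set_option maxHeartbeats 3200000 in -- long binder lists of the two doors
/-- **`ScaleCovData` of the tower's step covariance at the top flow frame for ALL steps** (see the module docstring).
[cite: BenfattoGiulianiMastropietro2006, §2.8 (2.80)–(2.81), §3 (3.2)–(3.8)] -/
theorem scaleCovData_klStepCov_flow_all (dd : ℕ) (hdd : 10 ≤ dd) :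
    ∃ Cκ Cα ρc : ℝ, 0 < Cκ ∧ 0 < Cα ∧ 0 < ρc ∧
      ∀ (G : GeoConsts) (P : SplitConsts) (R : RenConsts) (Q : EngConsts) (cc : ℝ), P.WF → R.WF2 → 0 < cc → cc ≤ EngineV8.klEngC₃6 P R →
      ∀ μ ∈ klWindowC, ∀ U : ℝ, 0 < U → U ≤ min (EngineV8.klEngU₀3 P R cc) (1 / (R.Gfr 3 + 1)) → U ≤ EngineV8.klEngU₀4 P R cc →
      ∀ β : ℝ, klBetaMin ≤ β → β ≤ Real.exp (cc / U ^ 2) →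
      ∀ (L M : ℕ) [NeZero L] [NeZero M], EngineV8.klEngL₃ β U ≤ L → EngineV8.klEngM₃ β U L ≤ M →
      ∀ n : ℕ, 1 ≤ n → n ≤ nScales β + 1 → HistP klPredsV17F2 L M G P Q R β U μ 0 n →
        ∀ (V : ℕ) [NeZero V], EngineV8.klEngL₃ β U ≤ V → EngineV8.klEngM₃ β U V ≤ M →
        ∀ k : ℕ, 1 ≤ k → k + 2 ≤ nScales β + 1 →
        ∀ Λw : ℝ, 0 ≤ Λw → Λw ≤ klScale klE0 (k + 2) → Λw * (4 : ℝ) ^ n ≤ ρc →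
          ScaleCovData (klStepCov V M β μ (klFlowFrameU L M β U μ n) k) Λw
            (Real.sqrt (Cκ * (klScale klE0 k / klScale klE0 (k + 2)) * (klE0 * ((8 : ℝ) ^ k)⁻¹)))
            (Cα * ((M : ℝ) / β) / klScale klE0 (k + 2)) (16 * Cκ * klE0) := by
  obtain ⟨Cκ₁, Cα₁, Ce₁, hCκ₁, hCα₁, hCe₁, hdeep⟩ := scaleCovData_klStepCov_klEng_flow_deep_vol dd
  obtain ⟨Cκ₂, Cα₂, ρc, hCκ₂, hCα₂, hρc, hshallow⟩ := scaleCovData_klStepCov_flow_shallow dd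
  obtain ⟨Cκ, hCκ, hgram⟩ := gram_entry_klStepCov_klEng
  refine ⟨Cκ, max Cα₁ Cα₂, ρc, hCκ, lt_max_of_lt_left hCα₁, hρc, ?_⟩
  intro G P R Q cc hP hR2 hcc hcc6 μ hμ U hU hUle hU4 β hβmin hβc L M _ _ hL3 hM3 n hn1 hnN hhist V _ hV3 hVM3 k hk hkN Λw hΛw0 hΛwle hΛwρ
  have hβ0 : 0 < β := pos_of_klBetaMin_le hβmin
  have he : (0 : ℝ) < klE0 := by norm_num [klE0]
  have hMβ : β ≤ (M : ℝ) := EngineV8.le_of_klEngM₃_le hβmin hL3 hM3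
  have hM0 : (0 : ℝ) < M := lt_of_lt_of_le hβ0 hMβ
  have hΛs : 0 < klScale klE0 (k + 2) := klth_klScale_pos _
  have hfr : FrameOK R U (nScales β) μ (klFlowFrameU L M β U μ n) := frameOK_klFlowFrameU_of_histP_le hR2 hn1 le_rfl hnN hhist
  have hU1 : U ≤ 1 := ((hUle.trans (min_le_left _ _)).trans (EngineV8.klEngU₀3_le_two_pow P R cc)).trans (by norm_num)
  -- the window-free Gram constant and entry sup at the top frame
  obtain ⟨hent, hgr⟩ := hgram P R cc hP hR2 hcc (hcc6.trans (EngineV8.klEngC₃6_le_klEngC₃3 P R)) μ hμ U hU hU4 β hβmin hβc _ hfr V M hV3 hVM3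
    k hk (by omega)
  have h16 : klScale klE0 k / klScale klE0 (k + 2) = 16 := klScale_div_klScale_add_two k
  have hent' : ∀ Y Y' : SpaceTimeIdx V M × SectorLeg (sectorCount k), ‖klStepCov V M β μ (klFlowFrameU L M β U μ n) k Y Y'‖ ≤ 16 * Cκ * klE0 := fun Y Y' => by
    refine (hent Y Y').trans ?_
    rw [h16]
    have h8 : ((8 : ℝ) ^ k)⁻¹ ≤ 1 := inv_le_one_of_one_le₀ (one_le_pow₀ (by norm_num))
    calc Cκ * 16 * (klE0 * ((8 : ℝ) ^ k)⁻¹) = 16 * Cκ * klE0 * ((8 : ℝ) ^ k)⁻¹ := by ring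
      _ ≤ 16 * Cκ * klE0 * 1 := mul_le_mul_of_nonneg_left h8 (by positivity)
      _ = 16 * Cκ * klE0 := mul_one _
  have hκpos : 0 < Real.sqrt (Cκ * (klScale klE0 k / klScale klE0 (k + 2)) * (klE0 * ((8 : ℝ) ^ k)⁻¹)) := Real.sqrt_pos.2 (by positivity)
  have hαpos : 0 < max Cα₁ Cα₂ * ((M : ℝ) / β) / klScale klE0 (k + 2) := by
    have : 0 < max Cα₁ Cα₂ := lt_max_of_lt_left hCα₁
    positivity
  have hmono : ∀ {C₀ : ℝ}, C₀ ≤ max Cα₁ Cα₂ → C₀ * ((M : ℝ) / β) / klScale klE0 (k + 2) ≤ max Cα₁ Cα₂ * ((M : ℝ) / β) / klScale klE0 (k + 2) :=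
    fun h => div_le_div_of_nonneg_right (mul_le_mul_of_nonneg_right h (by positivity)) hΛs.le
  by_cases hwin : (4 : ℝ) ^ (n + 2) * U ≤ (4 : ℝ) ^ (2 * k + dd)
  · -- deep: the `_vol` door at the top frame
    have hD := hdeep G P R Q cc hP hR2 hcc hcc6 μ hμ U hU hUle hU4 β hβmin hβc L M hL3 hM3 n hn1 hnN hhist hfr V hV3 hVM3 k hk hkN hwin Λw hΛw0 hΛwle
    exact ⟨hκpos, hgr, hαpos, fun X => (hD.row X).trans (hmono (le_max_left _ _)), fun Y => (hD.col Y).trans (hmono (le_max_left _ _)),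
      by positivity, hent'⟩
  · -- shallow: the frame telescope from the base `m₀ = 2k+6`
    have hm₀n : 2 * k + 6 ≤ n := by
      by_contra hlt
      apply hwin
      have hle : n + 2 ≤ 2 * k + 8 := by omega
      calc (4 : ℝ) ^ (n + 2) * U ≤ (4 : ℝ) ^ (n + 2) * 1 := mul_le_mul_of_nonneg_left hU1 (by positivity)
        _ ≤ (4 : ℝ) ^ (2 * k + 8) := by rw [mul_one]; exact pow_le_pow_right₀ (by norm_num) hle
        _ ≤ (4 : ℝ) ^ (2 * k + dd) := pow_le_pow_right₀ (by norm_num) (by omega)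
    obtain ⟨d, rfl⟩ : ∃ d, n = 2 * k + 6 + d := ⟨n - (2 * k + 6), by omega⟩
    have hbase : (4 : ℝ) ^ (2 * k + 6 + 2) * U ≤ (4 : ℝ) ^ (2 * k + dd) :=
      calc (4 : ℝ) ^ (2 * k + 6 + 2) * U ≤ (4 : ℝ) ^ (2 * k + 6 + 2) * 1 := mul_le_mul_of_nonneg_left hU1 (by positivity)
        _ ≤ (4 : ℝ) ^ (2 * k + dd) := by rw [mul_one]; exact pow_le_pow_right₀ (by norm_num) (by omega)
    have hS := hshallow G P R Q cc hP hR2 hcc hcc6 μ hμ U hU hUle hU4 β hβmin hβc L M hL3 hM3 (2 * k + 6) d (by omega) hnN hhist V hV3 hVM3 k hk hkN le_rfl hbase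
      Λw hΛw0 hΛwle hΛwρ
    exact ⟨hκpos, hgr, hαpos, fun X => (hS.row X).trans (hmono (le_max_right _ _)), fun Y => (hS.col Y).trans (hmono (le_max_right _ _)),
      by positivity, hent'⟩

end Summit.HubbardSuperconductivity.HubbardSuperconductivity.Theorems.TorusFourierL2

end
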